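import Summits.ValiantsHypothesis.ValiantsHypothesis.Theorems.BarrierLeverChowBenchmarkPairsPureSplittable

/-!
# Route BarrierLever — item 22038 `ChowBenchmarkPairs`, line `moore-peel`: pure-splittable families WITH REINDEXING,
# and the CHAIN (forest) theorem — every weighted family with a pendant ordering is Haar on any column chain

Helper file (`--supports stmt-ValiantsHypothesis-22038`; cell valiant-natproofs, rung V4; seat val-np-p4 gen 23).  Closes NO item.

`…PureSplittable.PS` presents families in `Sum.elim` shape.  This file adds the harmless REINDEX rule (`PSr.reindex`, soundness by
`Matrix.det_submatrix_equiv_self`) so that families indexed by `Fin n` (the line's shape) can be certified, re-proves THEOREM PS for the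
extended predicate (`det_genTable_ne_zero_of_psr`, `exists_table_of_psr`), and derives the first infinite class in closed form:

**CHAIN THEOREM** (`psr_chain`, `det_genTable_ne_zero_of_chain`): rows `S t` (`t < j`) each containing a point `q t` that lies in NO EARLIER
row, with weight `≥ 1` there, and columns `T t` with `T t ⊄ T s` for `s < t` (e.g. ANY `j` distinct codes in increasing order), form a
pure-splittable family; hence their generic determinant is nonzero and some complex table makes them nonsingular.  Paths, stars, matchings,
forests (with or without the row `∅` first) are chains; in HAAR's language: every pendant-orderable row family is Haar on every initial code
segment — now as ONE kernel theorem rather than an iteration recipe.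

WHAT THIS IS NOT: no stub of the line is closed; nothing on crux stmt-ValiantsHypothesis-14610 or on `VP` versus `VNP`.
-/

set_option linter.dupNamespace false

namespace Summit.ValiantsHypothesis.ValiantsHypothesis.Theorems.BarrierLever.ChowBenchmarkSplit

open Finset Polynomial
open Summit.ValiantsHypothesis.ValiantsHypothesis.Theorems.BarrierLever.ChowBenchmarkPeel (indPt)

variable {κ : Type*} [DecidableEq κ] {π : Type*} [DecidableEq π]

/-! ## 1. Pure-splittable with reindexing -/

/-- **Pure-splittable weighted row families, with reindexing** (`PS` plus transport along an equivalence of the index type). -/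
inductive PSr : ∀ {ι : Type} [Fintype ι] [DecidableEq ι], (ι → Finset π) → (ι → π → ℕ) → (ι → Finset κ) → Prop
  | empty {ι : Type} [Fintype ι] [DecidableEq ι] [IsEmpty ι] (S : ι → Finset π) (w : ι → π → ℕ) (T : ι → Finset κ) : PSr S w T
  | pendant {ι : Type} [Fintype ι] [DecidableEq ι] {S : ι → Finset π} {w : ι → π → ℕ} {T : ι → Finset κ} (h : PSr S w T)
      (Snew : Finset π) (wnew : π → ℕ) (q : π) (hq : q ∈ Snew) (hqS : ∀ i, q ∉ S i) (hwq : 1 ≤ wnew q)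
      (U : Finset κ) (hU : ∀ j, ¬ U ⊆ T j) :
      PSr (Sum.elim S (fun _ : Unit => Snew)) (Sum.elim w (fun _ : Unit => wnew)) (Sum.elim T (fun _ : Unit => U))
  | split {ι₁ ι₂ : Type} [Fintype ι₁] [DecidableEq ι₁] [Fintype ι₂] [DecidableEq ι₂]
      {S₁ : ι₁ → Finset π} {w₁ : ι₁ → π → ℕ} {T₁ : ι₁ → Finset κ} {S₂ : ι₂ → Finset π} {w₂ : ι₂ → π → ℕ} {T₂ : ι₂ → Finset κ}
      (c : κ) (I : Finset π) (ρ : π → ℕ) (y : ι₂ → π)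
      (h₁ : PSr S₁ w₁ T₁) (h₂ : PSr S₂ (fun i => Function.update (w₂ i) (y i) (w₂ i (y i) + 1)) T₂)
      (hT₁ : ∀ j, c ∉ T₁ j) (hT₂ : ∀ j, c ∉ T₂ j) (hS₁ : ∀ i, ∀ a ∈ S₁ i, a ∉ I)
      (hyS : ∀ i, y i ∈ S₂ i) (hyI : ∀ i, y i ∈ I) (hdom : ∀ i, ∀ a ∈ S₂ i, a ∈ I → a ≠ y i → ρ (y i) < ρ a)
      (hw : ∀ i, 1 ≤ w₂ i (y i)) :
      PSr (Sum.elim S₁ S₂) (Sum.elim w₁ w₂) (Sum.elim T₁ (fun j => insert c (T₂ j)))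
  | reindex {ι ι' : Type} [Fintype ι] [DecidableEq ι] [Fintype ι'] [DecidableEq ι']
      {S : ι → Finset π} {w : ι → π → ℕ} {T : ι → Finset κ} (h : PSr S w T) (e : ι' ≃ ι) :
      PSr (fun i => S (e i)) (fun i => w (e i)) (fun j => T (e j))

/-- **THEOREM PS with reindexing.**  A `PSr` family has a nonzero determinant at the generic table. -/
theorem det_genTable_ne_zero_of_psr [Fintype π] [Fintype κ] {ι : Type} [Fintype ι] [DecidableEq ι]
    {S : ι → Finset π} {w : ι → π → ℕ} {T : ι → Finset κ} (h : PSr S w T) :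
    (Matrix.of fun i j : ι => dirE (genT : π → κ → MvPolynomial (π × κ) ℂ) (S i) (w i) (T j)).det ≠ 0 := by
  classical
  induction h with
  | empty S w T =>
    rw [Matrix.det_isEmpty]
    exact one_ne_zero
  | @pendant ι _ _ S w T h Snew wnew q hq hqS hwq U hU ih =>
    set R₀ := MvPolynomial (π × κ) ℂ
    have hw' : (((wnew q).ascFactorial U.card : ℕ) : R₀) ≠ 0 := by
      have hpos : 0 < (wnew q).ascFactorial U.card := by
        have := Nat.ascFactorial_pos (wnew q - 1) U.card
        rwa [Nat.sub_add_cancel hwq] at this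
      exact Nat.cast_ne_zero.mpr (Nat.pos_iff_ne_zero.mp hpos)
    have hX := det_pendMatrixX_ne_zero (genT : π → κ → R₀) q S w Snew wnew T U hqS hq hw' hU ih
    set ψ := MvPolynomial.aeval (R := ℂ) (S₁ := R₀[X])
      (fun p : π × κ => if p.1 = q then indPt U (X : R₀[X]) p.2 else C (MvPolynomial.X p)) with hψ
    intro hD
    apply hX
    have e : pendMatrixX (genT : π → κ → R₀) q S w Snew wnew T U =
        ψ.toRingHom.mapMatrix (Matrix.of fun i j : ι ⊕ Unit =>
          dirE (genT : π → κ → R₀) (Sum.elim S (fun _ : Unit => Snew) i) (Sum.elim w (fun _ : Unit => wnew) i)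
            (Sum.elim T (fun _ : Unit => U) j)) := by
      refine Matrix.ext fun i j => ?_
      rw [RingHom.mapMatrix_apply, Matrix.map_apply, Matrix.of_apply, pendMatrixX, Matrix.of_apply, map_dirE]
      congr 1
      funext a c
      exact (aeval_genT_pend q U a c).symm
    rw [e, ← RingHom.map_det, hD, map_zero]
  | @split ι₁ ι₂ _ _ _ _ S₁ w₁ T₁ S₂ w₂ T₂ c I ρ y h₁ h₂ hT₁ hT₂ hS₁ hyS hyI hdom hw ih₁ ih₂ =>
    set R₀ := MvPolynomial (π × κ) ℂ
    have hw' : ∀ i, (w₂ i (y i) : R₀) ≠ 0 := fun i =>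
      Nat.cast_ne_zero.mpr (Nat.pos_iff_ne_zero.mp (hw i))
    have hX := det_splitMatrixX_ne_zero (genT : π → κ → R₀) c I ρ S₁ w₁ S₂ w₂ T₁ T₂ hT₁ hT₂ hS₁ y hyS hyI hdom hw' ih₁ ih₂
    set φ := MvPolynomial.aeval (R := ℂ) (S₁ := R₀[X])
      (fun p : π × κ => if p.2 = c then (if p.1 ∈ I then (X : R₀[X]) ^ ρ p.1 else 0) else C (MvPolynomial.X p)) with hφ
    intro hD
    apply hX
    have e : splitMatrixX (genT : π → κ → R₀) c I ρ S₁ w₁ S₂ w₂ T₁ T₂ =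
        φ.toRingHom.mapMatrix (Matrix.of fun i j : ι₁ ⊕ ι₂ =>
          dirE (genT : π → κ → R₀) (Sum.elim S₁ S₂ i) (Sum.elim w₁ w₂ i) (Sum.elim T₁ (fun j => insert c (T₂ j)) j)) := by
      refine Matrix.ext fun i j => ?_
      rw [RingHom.mapMatrix_apply, Matrix.map_apply, Matrix.of_apply, splitMatrixX, Matrix.of_apply, map_dirE]
      congr 1
      funext a c'
      exact (aeval_genT_split c I ρ a c').symm
    rw [e, ← RingHom.map_det, hD, map_zero]
  | @reindex ι ι' _ _ _ _ S w T h e ih =>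
    have hsub : (Matrix.of fun i j : ι' => dirE (genT : π → κ → MvPolynomial (π × κ) ℂ) (S (e i)) (w (e i)) (T (e j))) =
        (Matrix.of fun i j : ι => dirE (genT : π → κ → MvPolynomial (π × κ) ℂ) (S i) (w i) (T j)).submatrix e e := by
      refine Matrix.ext fun i j => ?_
      rw [Matrix.submatrix_apply, Matrix.of_apply, Matrix.of_apply]
    rw [hsub, Matrix.det_submatrix_equiv_self]
    exact ih

/-- **Existence form**: some complex table makes a `PSr` family nonsingular. -/
theorem exists_table_of_psr [Fintype π] [Fintype κ] {ι : Type} [Fintype ι] [DecidableEq ι]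
    {S : ι → Finset π} {w : ι → π → ℕ} {T : ι → Finset κ} (h : PSr S w T) :
    ∃ P : π → κ → ℂ, (Matrix.of fun i j : ι => dirE P (S i) (w i) (T j)).det ≠ 0 := by
  classical
  have hD := det_genTable_ne_zero_of_psr h
  by_contra hall
  push Not at hall
  apply hD
  apply MvPolynomial.funext
  intro x
  rw [map_zero, RingHom.map_det]
  have e : (MvPolynomial.eval x).mapMatrix
      (Matrix.of fun i j : ι => dirE (genT : π → κ → MvPolynomial (π × κ) ℂ) (S i) (w i) (T j)) =
      Matrix.of fun i j : ι => dirE (fun a c => x (a, c)) (S i) (w i) (T j) := by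
    refine Matrix.ext fun i j => ?_
    rw [RingHom.mapMatrix_apply, Matrix.map_apply, Matrix.of_apply, Matrix.of_apply, map_dirE]
    congr 1
    funext a c
    simp [genT]
  rw [e]
  exact hall _

/-! ## 2. Chains (pendant orderings) -/

/-- **CHAIN THEOREM.**  Rows `S t`, `t : Fin j`, each with a point `q t ∈ S t` lying in no EARLIER row (`s < t ⇒ q t ∉ S s`) and weight `≥ 1` at `q t`,
on columns `T t` with `T t ⊄ T s` for `s < t`, form a pure-splittable family. -/
theorem psr_chain [Fintype π] [Fintype κ] :
    ∀ (j : ℕ) (S : Fin j → Finset π) (w : Fin j → π → ℕ) (T : Fin j → Finset κ) (q : Fin j → π),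
      (∀ t, q t ∈ S t) → (∀ s t, s < t → q t ∉ S s) → (∀ t, 1 ≤ w t (q t)) → (∀ s t, s < t → ¬ T t ⊆ T s) →
      PSr S w T := by
  intro j
  induction j with
  | zero =>
    intro S w T q _ _ _ _
    exact PSr.empty S w T
  | succ j ih =>
    intro S w T q hq hfresh hw hT
    -- the first `j` rows
    have hold : PSr (fun t : Fin j => S (Fin.castSucc t)) (fun t => w (Fin.castSucc t)) (fun t => T (Fin.castSucc t)) :=
      ih _ _ _ (fun t => q (Fin.castSucc t)) (fun t => hq _)
        (fun s t hst => hfresh _ _ (Fin.castSucc_lt_castSucc_iff.mpr hst)) (fun t => hw _)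
        (fun s t hst => hT _ _ (Fin.castSucc_lt_castSucc_iff.mpr hst))
    -- adjoin the last row (pendant at `q (Fin.last j)`) and reindex `Fin j ⊕ Unit ≃ Fin (j+1)`
    have hpend := PSr.pendant hold (S (Fin.last j)) (w (Fin.last j)) (q (Fin.last j)) (hq _)
      (fun i => hfresh _ _ (Fin.castSucc_lt_last i)) (hw _) (T (Fin.last j)) (fun i => hT _ _ (Fin.castSucc_lt_last i))
    let e : Fin (j + 1) ≃ Fin j ⊕ Unit := finSuccEquivLast.trans (Equiv.optionEquivSumPUnit (Fin j))
    have key := PSr.reindex hpend e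
    have hS : (fun i => Sum.elim (fun t : Fin j => S (Fin.castSucc t)) (fun _ : Unit => S (Fin.last j)) (e i)) = S := by
      funext i
      induction i using Fin.lastCases with
      | last => simp [e, finSuccEquivLast_last]
      | cast t => simp [e, finSuccEquivLast_castSucc]
    have hw' : (fun i => Sum.elim (fun t : Fin j => w (Fin.castSucc t)) (fun _ : Unit => w (Fin.last j)) (e i)) = w := by
      funext i
      induction i using Fin.lastCases with
      | last => simp [e, finSuccEquivLast_last]
      | cast t => simp [e, finSuccEquivLast_castSucc]
    have hT' : (fun i => Sum.elim (fun t : Fin j => T (Fin.castSucc t)) (fun _ : Unit => T (Fin.last j)) (e i)) = T := by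
      funext i
      induction i using Fin.lastCases with
      | last => simp [e, finSuccEquivLast_last]
      | cast t => simp [e, finSuccEquivLast_castSucc]
    rw [hS, hw', hT'] at key
    exact key

/-- **Chains have a nonzero generic determinant** (THEOREM PS applied to `psr_chain`). -/
theorem det_genTable_ne_zero_of_chain [Fintype π] [Fintype κ] (j : ℕ) (S : Fin j → Finset π) (w : Fin j → π → ℕ)
    (T : Fin j → Finset κ) (q : Fin j → π) (hq : ∀ t, q t ∈ S t) (hfresh : ∀ s t, s < t → q t ∉ S s)
    (hw : ∀ t, 1 ≤ w t (q t)) (hT : ∀ s t, s < t → ¬ T t ⊆ T s) :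
    (Matrix.of fun s t : Fin j => dirE (genT : π → κ → MvPolynomial (π × κ) ℂ) (S s) (w s) (T t)).det ≠ 0 :=
  det_genTable_ne_zero_of_psr (psr_chain j S w T q hq hfresh hw hT)

/-- **Chains are nonsingular at some complex table.** -/
theorem exists_table_of_chain [Fintype π] [Fintype κ] (j : ℕ) (S : Fin j → Finset π) (w : Fin j → π → ℕ)
    (T : Fin j → Finset κ) (q : Fin j → π) (hq : ∀ t, q t ∈ S t) (hfresh : ∀ s t, s < t → q t ∉ S s)
    (hw : ∀ t, 1 ≤ w t (q t)) (hT : ∀ s t, s < t → ¬ T t ⊆ T s) :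
    ∃ P : π → κ → ℂ, (Matrix.of fun s t : Fin j => dirE P (S s) (w s) (T t)).det ≠ 0 :=
  exists_table_of_psr (psr_chain j S w T q hq hfresh hw hT)

end Summit.ValiantsHypothesis.ValiantsHypothesis.Theorems.BarrierLever.ChowBenchmarkSplit
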